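import Literature.Analysis.FluidPDE.LerayPressureDecayProofs
import Literature.Analysis.FluidPDE.LocalLerayPressureRenormalisation
import Literature.Analysis.FluidPDE.LocalLerayCubicIntegrability
import Literature.Analysis.FluidPDE.ForwardDSSLocalEnergyScaling
import HarnessLib

/-!
# Forward DSS solutions: the gauged pressure of a DSS local Leray solution and its local
  `L^{3/2}` bound (Bradshaw–Tsai 2019, (3.3)/(3.8) and the pressure bounds of p. 10, for the
  Kang–Miura–Tsai expansion)

Analysis/FluidPDE proof file (theorems only, no new definitions) under the named fact
`Literature.Analysis.FluidPDE.bradshawTsai2019_prop_3_1` (Bradshaw–Tsai, Analysis & PDE 12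
(2019) = arXiv:1801.08060, Prop. 3.1; `ForwardDSSExistence.lean`), on the line proving Prop. 3.1
for **every** `λ`-DSS local Leray solution. The printed proof of Prop. 3.1 controls the pressure
of the approximants through the explicit formula (3.8)
`π_ε = −⅓|…|² + p.v.∫ K(x−y) … dy`, split on p. 10 into a near field ("the Calderon-Zygmund
theory") and a far field bounded on the `λ`-adic annuli `A_k = {λᵏ ≤ |x| < λᵏ⁺¹}` by the
scaling law (3.6): "`|π_far(x,t)| ≤ C Σ_k λ^{−4k} ∫_{A_k} |v_ε|² ≤ C(λ) α̃_ε(t)`". For a general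
local Leray solution `(v, π)` (Kang–Miura–Tsai Def. 3.2 = `IsLocalLeraySolution 1 v₀ v π`) the
same structure is available through the **local pressure expansion** (Kang–Miura–Tsai 2021,
Lemma 3.4 = the tree's `kangMiuraTsai_pressure_decomposition`, **PD**):
`π − c_{x₀,r}(t) = π_loc + π_far` on `(0,T) × B_r(x₀)`, with `π_loc` the Riesz-transform
pressure of `1_{B_{2r}(x₀)}v` (bounded by Stein's theorem, the tree's
`stein1970_normalisedPressure_ae_Lp_bound`, **CZ**) and `π_far` the two-centre far field. This
file proves:

* `exists_gaugedPressure` — **the gauged pressure**: under **PD**, for a local Leray solution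
  `(v, π)` with weakly divergence free `E²` datum and a radius `r > 0` there is a pressure `ϖ`
  (`π` minus a *measurable* function of time) with `(v, ϖ)` again a local Leray solution with
  the same datum (accepted `IsLocalLeraySolution.sub_pressure`) and
  `ϖ = π_loc + π_far` a.e. on `(0,T) × B_r(0)` for every `T > 0` (accepted
  `exists_gauge_of_pressure_decomposition`, made measurable by `AEStronglyMeasurable.mk` on
  `(0,∞) = ⋃ₙ (0,n+1)`);
* `exists_lintegral_far_le_of_dss` — **the far field of a `λ`-DSS field on `λ`-adic shells**
  (p. 10): there is `C_f = C_f(λ, r) < ∞` with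
  `∫_{|y| ≥ 2r} |w(t,y)|² |y|⁻⁴ dy ≤ C_f A` whenever `∫_{B₁}|w(λ^{-2(j+1)} t)|² ≤ A` for all `j`
  (shells `{2rλᵏ ≤ |y| < 2rλᵏ⁺¹}`, `|y|⁻⁴ ≤ (2rλᵏ)⁻⁴` there, `∫_{B_{λʲ}}|w(t)|² = λʲ∫_{B₁}|w(λ⁻²ʲt)|²`
  by (3.6) — accepted `setLIntegral_ball_enorm_sq_eq_ballEnergy` for the `λʲ`-DSS field —, and the
  geometric series `Σ_k λ^{−3k}`, `ENNReal.tsum_geometric`);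
* `exists_gaugedPressure_cylinder_le` — **the `L^{3/2}` bound on cylinders** (the three displayed
  bounds of p. 10 in the gauged setting): there is `C_p = C_p(λ, r, C_CZ, C_K) < ∞` such that for
  every local Leray solution `(v, ϖ)` with `v` `λ`-DSS and `ϖ = π_loc + π_far` a.e. on
  `(0,T) × B_r(0)`, and every majorant `m` with `∫_{B₁}|v(λ^{-2(j+1)}t)|² ≤ m(t)` for all `j`,
  a.e. `t ∈ (0,T)`:
  `∫∫_{(0,T)×B_r} |ϖ|^{3/2} ≤ C_p ∫∫_{(0,T)×B_{2r}} |v|³ + C_p ∫₀ᵀ m(t)^{3/2} dt`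
  (near field: **CZ** slice-wise, accepted `exists_lintegral_localPressureNear_le`; far field:
  the pointwise two-centre bound, accepted `enorm_localPressureFar_le`, and the shell estimate;
  Tonelli).

The majorant is instantiated downstream by the running essential supremum
`α̃(t) = esssup_{s<t} ∫_{B₁}|v(s)|²` (`ForwardDSSRunningSup.lean`).

## References

* Z. Bradshaw, T.-P. Tsai, Analysis & PDE 12 (2019) 1943–1962 = arXiv:1801.08060, §3: (3.3),
  (3.6), (3.8), the pressure bounds of p. 10 (`π_near` by Calderón–Zygmund, `π_far` on the
  annuli `A_k`) [BradshawTsai2019].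
* K. Kang, H. Miura, T.-P. Tsai, IMRN 2021 = arXiv:1812.10509, Lemma 3.4 and §8 (the local
  pressure expansion and the bounds for `p_loc`, `p_far`) [KangMiuraTsai2020].
* E. M. Stein, *Singular integrals and differentiability properties of functions* (1970), Ch. II
  §4.2 Thm 3, §4.5 Thm 4 [Stein1971].
-/

noncomputable section

open MeasureTheory Set Function Filter Topology TopologicalSpace Metric
open scoped NNReal ENNReal

namespace Literature.Analysis.FluidPDE

namespace BradshawTsai2019

/-! ## The gauged pressure -/

/-- **The gauged pressure of a local Leray solution** (Kang–Miura–Tsai 2021, Lemma 3.4, with the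
normalisation freedom of the pressure; Bradshaw–Tsai 2019, p. 9: "we can re-define `π_ε` to
equal `π_ε − π_*(t)`"). Under **PD**, for a local Leray solution `(v, π)` with weakly divergence
free datum `v₀ ∈ E²` and `r > 0` there is a pressure `ϖ = π − c(t)`, `c` measurable with
`c ∈ L^{3/2}(0,T)` for all `T`, such that `(v, ϖ)` is a local Leray solution with datum `v₀` and
`ϖ = π_loc + π_far` a.e. on `(0,T) × B_r(0)` for every `T > 0` (`π_loc = localPressureNear 0 r v`,
`π_far = localPressureFar 0 r v`). [cite: KangMiuraTsai2020, Lemma 3.4 (arXiv:1812.10509 p. 8); BradshawTsai2019 §3 p. 9 (normalisation of the pressure)] -/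
theorem exists_gaugedPressure (hPD : kangMiuraTsai_pressure_decomposition)
    {v₀ : EuclideanSpace ℝ (Fin 3) → EuclideanSpace ℝ (Fin 3)} (hE2 : MemE2 v₀)
    (hdiv : IsWeaklyDivFree v₀)
    {v : ℝ → EuclideanSpace ℝ (Fin 3) → EuclideanSpace ℝ (Fin 3)}
    {π : ℝ → EuclideanSpace ℝ (Fin 3) → ℝ} (hv : IsLocalLeraySolution 1 v₀ v π) {r : ℝ}
    (hr : 0 < r) :
    ∃ ϖ : ℝ → EuclideanSpace ℝ (Fin 3) → ℝ, IsLocalLeraySolution 1 v₀ v ϖ ∧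
      ∀ T : ℝ, 0 < T →
        ∀ᵐ z ∂(volume.restrict (Ioo 0 T ×ˢ ball (0 : EuclideanSpace ℝ (Fin 3)) r)),
          ϖ z.1 z.2 = localPressureNear 0 r v z.1 z.2 + localPressureFar 0 r v z.1 z.2 := by
  obtain ⟨c₀, hc₀⟩ := exists_gauge_of_pressure_decomposition hPD hE2 hdiv hv 0 hr
  -- a measurable modification of the gauge on `(0, ∞) = ⋃ₙ (0, n+1)`
  have hIoi : Ioi (0 : ℝ) = ⋃ n : ℕ, Ioo (0 : ℝ) ((n : ℝ) + 1) := by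
    ext t
    simp only [mem_Ioi, mem_iUnion, mem_Ioo]
    constructor
    · intro ht
      obtain ⟨n, hn⟩ := exists_nat_gt t
      exact ⟨n, ht, hn.trans (lt_add_one _)⟩
    · rintro ⟨n, ht, -⟩
      exact ht
  have hc₀m : AEStronglyMeasurable c₀ (volume.restrict (Ioi (0 : ℝ))) := by
    rw [hIoi]
    exact aestronglyMeasurable_iUnion_iff.2 fun n =>
      (hc₀ ((n : ℝ) + 1) (by positivity)).1.aestronglyMeasurable
  set c : ℝ → ℝ := hc₀m.mk c₀ with hc
  have hcm : Measurable c := hc₀m.stronglyMeasurable_mk.measurable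
  have hcc : ∀ T : ℝ, c₀ =ᵐ[volume.restrict (Ioo (0 : ℝ) T)] c := fun T =>
    ae_restrict_of_ae_restrict_of_subset Ioo_subset_Ioi_self hc₀m.ae_eq_mk
  have hcLp : ∀ T : ℝ, 0 < T → MemLp c (3 / 2 : ℝ≥0∞) (volume.restrict (Ioo (0 : ℝ) T)) :=
    fun T hT => (hc₀ T hT).1.ae_eq (hcc T)
  -- the identity on the boxes
  have hdec : ∀ T : ℝ, 0 < T →
      ∀ᵐ z ∂(volume.restrict (Ioo 0 T ×ˢ ball (0 : EuclideanSpace ℝ (Fin 3)) r)),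
        π z.1 z.2 - c z.1 =
          localPressureNear 0 r v z.1 z.2 + localPressureFar 0 r v z.1 z.2 := by
    intro T hT
    have hprod : (volume.restrict (Ioo (0 : ℝ) T)).prod
        (volume.restrict (ball (0 : EuclideanSpace ℝ (Fin 3)) r)) =
        volume.restrict (Ioo 0 T ×ˢ ball (0 : EuclideanSpace ℝ (Fin 3)) r) := by
      rw [Measure.prod_restrict, ← Measure.volume_eq_prod]
    have hfst : (fun z : ℝ × EuclideanSpace ℝ (Fin 3) => c₀ z.1) =ᵐ[volume.restrict
        (Ioo 0 T ×ˢ ball (0 : EuclideanSpace ℝ (Fin 3)) r)] fun z => c z.1 := by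
      rw [← hprod]
      exact Measure.QuasiMeasurePreserving.ae_eq Measure.quasiMeasurePreserving_fst (hcc T)
    filter_upwards [(hc₀ T hT).2, hfst] with z hz hzc
    rw [← hzc, hz]
  -- `(v, π - c)` is a local Leray solution
  have hfin : ∀ T R : ℝ, 0 < T → 0 < R →
      ∫⁻ z in Ioo 0 T ×ˢ ball (0 : EuclideanSpace ℝ (Fin 3)) R,
        ‖π z.1 z.2 - c z.1‖ₑ ^ (3 / 2 : ℝ) < ∞ := by
    intro T R hT hR
    have hcme : Measurable fun t : ℝ => ‖c t‖ₑ ^ (3 / 2 : ℝ) := hcm.enorm.pow_const _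
    have hcz : Measurable fun z : ℝ × EuclideanSpace ℝ (Fin 3) => ‖c z.1‖ₑ ^ (3 / 2 : ℝ) :=
      (hcm.comp measurable_fst).enorm.pow_const _
    have hsplit : ∫⁻ z in Ioo 0 T ×ˢ ball (0 : EuclideanSpace ℝ (Fin 3)) R,
        ‖π z.1 z.2 - c z.1‖ₑ ^ (3 / 2 : ℝ) ≤
        (2 : ℝ≥0∞) ^ (1 / 2 : ℝ) *
          ((∫⁻ z in Ioo 0 T ×ˢ ball (0 : EuclideanSpace ℝ (Fin 3)) R,
              ‖π z.1 z.2‖ₑ ^ (3 / 2 : ℝ)) +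
            ∫⁻ z in Ioo 0 T ×ˢ ball (0 : EuclideanSpace ℝ (Fin 3)) R,
              ‖c z.1‖ₑ ^ (3 / 2 : ℝ)) := by
      calc ∫⁻ z in Ioo 0 T ×ˢ ball (0 : EuclideanSpace ℝ (Fin 3)) R,
            ‖π z.1 z.2 - c z.1‖ₑ ^ (3 / 2 : ℝ)
          ≤ ∫⁻ z in Ioo 0 T ×ˢ ball (0 : EuclideanSpace ℝ (Fin 3)) R,
              (2 : ℝ≥0∞) ^ (1 / 2 : ℝ) * (‖π z.1 z.2‖ₑ ^ (3 / 2 : ℝ) + ‖c z.1‖ₑ ^ (3 / 2 : ℝ)) :=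
            lintegral_mono fun z => enorm_sub_rpow_threeHalves_le _ _
        _ = _ := by
            rw [lintegral_const_mul' _ _ (ENNReal.rpow_ne_top_of_nonneg (by norm_num)
              ENNReal.ofNat_ne_top), lintegral_add_right' _ hcz.aemeasurable]
    refine lt_of_le_of_lt hsplit (ENNReal.mul_lt_top (ENNReal.rpow_lt_top_of_nonneg
      (by norm_num) ENNReal.ofNat_ne_top) (ENNReal.add_lt_top.2 ⟨?_, ?_⟩))
    · exact lt_of_le_of_lt (lintegral_mono_set (prod_mono Subset.rfl ball_subset_closedBall))
        (hv.pressure T hT (closedBall 0 R) (isCompact_closedBall 0 R))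
    · rw [lintegral_prod_of_time_only hcme, lintegral_rpow_threeHalves_eq c]
      exact ENNReal.mul_lt_top (ENNReal.rpow_lt_top_of_nonneg (by norm_num)
        (hcLp T hT).eLpNorm_ne_top) measure_ball_lt_top
  exact ⟨fun t x => π t x - c t, hv.sub_pressure hcm hfin, hdec⟩

/-! ## The far field of a DSS field on `λ`-adic shells -/

/-- **The far field of a `λ`-DSS field on `λ`-adic shells** (Bradshaw–Tsai 2019, p. 10: "Let
`A_k = {x : λᵏ ≤ |x| < λᵏ⁺¹}`. For `x ∈ B_λ(0)` and `0 < t ≤ 1`, we have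
`|π_far(x,t)| ≤ C Σ_k ∫_{A_k} |v_ε|²/|λᵏ − λ|³ ≤ C Σ_k λ^{−4k} ∫_{B_{λᵏ⁺¹}} |v_ε|² ≤ C(λ) α̃_ε(t)`").
For `λ > 1` and `r > 0` there is `C_f < ∞` such that for every `λ`-DSS field `w`, every time `t`
and every `A` with `∫_{B₁}|w(λ^{−2(j+1)}t)|² ≤ A` for all `j ∈ ℕ`:
`∫_{|y| ≥ 2r} |w(t,y)|² |y|⁻⁴ dy ≤ C_f A` (the shells `{2rλᵏ ≤ |y| < 2rλᵏ⁺¹}`, the sliced scaling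
law (3.6) on `B_{λʲ}` with `λʲ ≥ 2rλᵏ⁺¹`, and `Σ_k λ^{−3k} < ∞`). [cite: BradshawTsai2019, §3 proof of Prop 3.1 (bound for π_far, p. 10)] -/
theorem exists_lintegral_far_le_of_dss {c : ℝ} (hc : 1 < c) {r : ℝ} (hr : 0 < r) :
    ∃ Cf : ℝ≥0∞, Cf ≠ ⊤ ∧
      ∀ (w : ℝ → EuclideanSpace ℝ (Fin 3) → EuclideanSpace ℝ (Fin 3)),
        IsDiscretelySelfSimilar c w → ∀ (t : ℝ) (A : ℝ≥0∞),
        (∀ j : ℕ, ballEnergy w (((c ^ (j + 1)) ^ 2)⁻¹ * t) ≤ A) →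
          ∫⁻ y in (ball (0 : EuclideanSpace ℝ (Fin 3)) (2 * r))ᶜ,
            ‖w t y‖ₑ ^ (2 : ℕ) * RieszKernel.powKer 4 y ≤ Cf * A := by
  have hc0 : 0 < c := zero_lt_one.trans hc
  obtain ⟨m, hm⟩ : ∃ m : ℕ, 2 * r ≤ c ^ m :=
    (pow_unbounded_of_one_lt (2 * r) hc).imp fun _ h => h.le
  -- the ratio of the geometric series and the constant
  set q : ℝ := (c ^ 3)⁻¹ with hq
  have hq0 : 0 ≤ q := inv_nonneg.2 (by positivity)
  have hq1 : q < 1 := inv_lt_one_of_one_lt₀ (one_lt_pow₀ hc three_ne_zero)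
  set K₀ : ℝ := c ^ (1 + m) * ((2 * r) ^ 4)⁻¹ with hK₀
  have hK₀0 : 0 ≤ K₀ := by positivity
  have hgeo : (∑' k : ℕ, ENNReal.ofReal q ^ k) = (1 - ENNReal.ofReal q)⁻¹ :=
    ENNReal.tsum_geometric _
  have hgeo_top : (1 - ENNReal.ofReal q)⁻¹ ≠ ⊤ :=
    ENNReal.inv_ne_top.2 (tsub_pos_iff_lt.2 (ENNReal.ofReal_lt_one.2 hq1)).ne'
  refine ⟨ENNReal.ofReal K₀ * (1 - ENNReal.ofReal q)⁻¹,
    ENNReal.mul_ne_top ENNReal.ofReal_ne_top hgeo_top, fun w hw t A hA => ?_⟩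
  -- the shells
  set S : ℕ → Set (EuclideanSpace ℝ (Fin 3)) := fun k =>
    {y | 2 * r * c ^ k ≤ ‖y‖ ∧ ‖y‖ < 2 * r * c ^ (k + 1)} with hS
  have hSmeas : ∀ k, MeasurableSet (S k) := fun k =>
    (measurableSet_le measurable_const measurable_norm).inter
      (measurableSet_lt measurable_norm measurable_const)
  have hcover : (ball (0 : EuclideanSpace ℝ (Fin 3)) (2 * r))ᶜ ⊆ ⋃ k, S k := by
    intro y hy
    rw [mem_compl_iff, mem_ball_zero_iff, not_lt] at hy
    have h2r : (0 : ℝ) < 2 * r := by positivity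
    have hx : 1 ≤ ‖y‖ / (2 * r) := by rwa [le_div_iff₀ h2r, one_mul]
    obtain ⟨n, hn1, hn2⟩ := exists_nat_pow_near hx hc
    refine mem_iUnion.2 ⟨n, ?_, ?_⟩
    · have h1 := (le_div_iff₀ h2r).1 hn1
      show 2 * r * c ^ n ≤ ‖y‖
      linarith
    · have h2 := (div_lt_iff₀ h2r).1 hn2
      show ‖y‖ < 2 * r * c ^ (n + 1)
      linarith
  -- the bound on one shell
  have hshell : ∀ k : ℕ, ∫⁻ y in S k, ‖w t y‖ₑ ^ (2 : ℕ) * RieszKernel.powKer 4 y ≤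
      ENNReal.ofReal (K₀ * q ^ k) * A := by
    intro k
    have hρ : 0 < 2 * r * c ^ k := by positivity
    have hγ : 0 < c ^ (k + 1 + m) := by positivity
    have hwj : IsDiscretelySelfSimilar (c ^ (k + 1 + m)) w := isDiscretelySelfSimilar_pow hw _
    have hball : S k ⊆ ball (0 : EuclideanSpace ℝ (Fin 3)) (c ^ (k + 1 + m)) := by
      intro y hy
      rw [mem_ball_zero_iff]
      calc ‖y‖ < 2 * r * c ^ (k + 1) := hy.2
        _ ≤ c ^ m * c ^ (k + 1) := mul_le_mul_of_nonneg_right hm (by positivity)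
        _ = c ^ (k + 1 + m) := by rw [← pow_add, add_comm]
    -- the real algebra `c^{k+1+m} (2rcᵏ)^{-4} = K₀ qᵏ`
    have halg : c ^ (k + 1 + m) * (2 * r * c ^ k) ^ (-(4 : ℝ)) = K₀ * q ^ k := by
      rw [Real.rpow_neg hρ.le, show (4 : ℝ) = ((4 : ℕ) : ℝ) by norm_num, Real.rpow_natCast,
        hK₀, hq]
      have hck : c ^ k ≠ 0 := pow_ne_zero _ hc0.ne'
      have hx3 : (c ^ 3)⁻¹ ^ k = ((c ^ k) ^ 3)⁻¹ := by
        rw [inv_pow, ← pow_mul, ← pow_mul, mul_comm]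
      have hsplit : c ^ (k + 1 + m) = c ^ (1 + m) * c ^ k := by
        rw [← pow_add]; congr 1; ring
      rw [hx3, hsplit, mul_pow]
      field_simp
    calc ∫⁻ y in S k, ‖w t y‖ₑ ^ (2 : ℕ) * RieszKernel.powKer 4 y
        ≤ ∫⁻ y in S k, ‖w t y‖ₑ ^ (2 : ℕ) * ENNReal.ofReal ((2 * r * c ^ k) ^ (-(4 : ℝ))) :=
          setLIntegral_mono' (hSmeas k) fun y hy =>
            mul_le_mul' le_rfl (RieszKernel.powKer_le_const (by norm_num) hρ hy.1)
      _ = (∫⁻ y in S k, ‖w t y‖ₑ ^ (2 : ℕ)) * ENNReal.ofReal ((2 * r * c ^ k) ^ (-(4 : ℝ))) :=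
          lintegral_mul_const' _ _ ENNReal.ofReal_ne_top
      _ ≤ (∫⁻ y in ball (0 : EuclideanSpace ℝ (Fin 3)) (c ^ (k + 1 + m)), ‖w t y‖ₑ ^ (2 : ℕ)) *
            ENNReal.ofReal ((2 * r * c ^ k) ^ (-(4 : ℝ))) :=
          mul_le_mul' (lintegral_mono_set hball) le_rfl
      _ = ENNReal.ofReal (c ^ (k + 1 + m)) * ballEnergy w (((c ^ (k + 1 + m)) ^ 2)⁻¹ * t) *
            ENNReal.ofReal ((2 * r * c ^ k) ^ (-(4 : ℝ))) := by
          rw [setLIntegral_ball_enorm_sq_eq_ballEnergy hγ hwj t]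
      _ ≤ ENNReal.ofReal (c ^ (k + 1 + m)) * A * ENNReal.ofReal ((2 * r * c ^ k) ^ (-(4 : ℝ))) := by
          gcongr
          have e : k + 1 + m = (k + m) + 1 := by ring
          rw [e]
          exact hA (k + m)
      _ = ENNReal.ofReal (K₀ * q ^ k) * A := by
          rw [mul_right_comm, ← ENNReal.ofReal_mul (by positivity), halg]
  -- sum over the shells
  calc ∫⁻ y in (ball (0 : EuclideanSpace ℝ (Fin 3)) (2 * r))ᶜ,
        ‖w t y‖ₑ ^ (2 : ℕ) * RieszKernel.powKer 4 y
      ≤ ∫⁻ y in ⋃ k, S k, ‖w t y‖ₑ ^ (2 : ℕ) * RieszKernel.powKer 4 y := lintegral_mono_set hcover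
    _ ≤ ∑' k, ∫⁻ y in S k, ‖w t y‖ₑ ^ (2 : ℕ) * RieszKernel.powKer 4 y := lintegral_iUnion_le _ _
    _ ≤ ∑' k, ENNReal.ofReal (K₀ * q ^ k) * A := ENNReal.tsum_le_tsum hshell
    _ = (∑' k : ℕ, ENNReal.ofReal K₀ * ENNReal.ofReal q ^ k) * A := by
        rw [ENNReal.tsum_mul_right]
        congr 1
        refine tsum_congr fun k => ?_
        rw [ENNReal.ofReal_mul hK₀0, ENNReal.ofReal_pow hq0]
    _ = ENNReal.ofReal K₀ * (1 - ENNReal.ofReal q)⁻¹ * A := by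
        rw [ENNReal.tsum_mul_left, hgeo]

/-! ## The `L^{3/2}` bound for the gauged pressure on cylinders -/

/-- **The local `L^{3/2}` bound for the gauged pressure of a DSS local Leray solution**
(Bradshaw–Tsai 2019, the three displayed bounds of p. 10: the local term, `π_near` "Using the
Calderon-Zygmund theory", and `π_far` on the annuli `A_k`, here for the Kang–Miura–Tsai
expansion `ϖ = π_loc + π_far`). Fix `λ > 1` and `r > 0`. There is `C_p < ∞` (depending on `λ`,
`r`, Stein's constant and the two-centre kernel constant) such that: for every local Leray
solution `(v, ϖ)` whose velocity is `λ`-DSS, every `T`, if `ϖ = π_loc + π_far` a.e. on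
`(0,T) × B_r(0)` (`π_loc = localPressureNear 0 r v`, `π_far = localPressureFar 0 r v`) and
`m : ℝ → [0,∞]` dominates the rescaled unit-ball energies, `∫_{B₁}|v(λ^{−2(j+1)}t)|² ≤ m(t)` for
all `j`, a.e. `t ∈ (0,T)`, then
`∫∫_{(0,T)×B_r} |ϖ|^{3/2} ≤ C_p ∫∫_{(0,T)×B_{2r}} |v|³ + C_p ∫₀ᵀ m(t)^{3/2} dt`
(near field by **CZ** on a.e. slice, far field by `exists_lintegral_far_le_of_dss`, Tonelli). [cite: BradshawTsai2019, §3 proof of Prop 3.1 (pressure bounds, p. 10); KangMiuraTsai2020 §8 (bounds for p_loc, p_far)] -/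
theorem exists_gaugedPressure_cylinder_le (hCZ : stein1970_normalisedPressure_ae_Lp_bound)
    {c : ℝ} (hc : 1 < c) {r : ℝ} (hr : 0 < r) :
    ∃ Cp : ℝ≥0∞, Cp ≠ ⊤ ∧
      ∀ {ν : ℝ} {v₀ : EuclideanSpace ℝ (Fin 3) → EuclideanSpace ℝ (Fin 3)}
        {v : ℝ → EuclideanSpace ℝ (Fin 3) → EuclideanSpace ℝ (Fin 3)}
        {ϖ : ℝ → EuclideanSpace ℝ (Fin 3) → ℝ},
        IsLocalLeraySolution ν v₀ v ϖ → IsDiscretelySelfSimilar c v →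
        ∀ {T : ℝ} {m : ℝ → ℝ≥0∞},
          (∀ᵐ z ∂(volume.restrict (Ioo 0 T ×ˢ ball (0 : EuclideanSpace ℝ (Fin 3)) r)),
            ϖ z.1 z.2 = localPressureNear 0 r v z.1 z.2 + localPressureFar 0 r v z.1 z.2) →
          (∀ᵐ t ∂(volume.restrict (Ioo 0 T)), ∀ j : ℕ,
            ballEnergy v (((c ^ (j + 1)) ^ 2)⁻¹ * t) ≤ m t) →
          ∫⁻ z in Ioo 0 T ×ˢ ball (0 : EuclideanSpace ℝ (Fin 3)) r, ‖ϖ z.1 z.2‖ₑ ^ (3 / 2 : ℝ) ≤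
            Cp * (∫⁻ z in Ioo 0 T ×ˢ ball (0 : EuclideanSpace ℝ (Fin 3)) (2 * r),
                ‖v z.1 z.2‖ₑ ^ (3 : ℕ)) +
              Cp * ∫⁻ t in Ioo 0 T, m t ^ (3 / 2 : ℝ) := by
  -- ## constants
  obtain ⟨Cn, hCn0, hCntop, hnear⟩ := exists_lintegral_localPressureNear_le hCZ
  obtain ⟨CK, hCK0, hCK⟩ := exists_abs_pressureKernel_sub_le
  obtain ⟨Cf, hCftop, hfarle⟩ := exists_lintegral_far_le_of_dss hc hr
  set s2 : ℝ≥0∞ := (2 : ℝ≥0∞) ^ (1 / 2 : ℝ) with hs2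
  set VB : ℝ≥0∞ := volume (ball (0 : EuclideanSpace ℝ (Fin 3)) r) with hVB
  set cK : ℝ≥0∞ := ENNReal.ofReal (CK * r) with hcK
  set α : ℝ≥0∞ := s2 * Cn with hα
  set β : ℝ≥0∞ := s2 * VB * (cK * Cf) ^ (3 / 2 : ℝ) with hβ
  have hs2top : s2 ≠ ⊤ := ENNReal.rpow_ne_top_of_nonneg (by norm_num) ENNReal.ofNat_ne_top
  have hVBtop : VB ≠ ⊤ := measure_ball_lt_top.ne
  have hcKtop : cK ≠ ⊤ := ENNReal.ofReal_ne_top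
  have hαtop : α ≠ ⊤ := ENNReal.mul_ne_top hs2top hCntop
  have hα0 : α ≠ 0 := mul_ne_zero (ENNReal.rpow_pos (by norm_num) ENNReal.ofNat_ne_top).ne' hCn0
  have hβtop : β ≠ ⊤ := ENNReal.mul_ne_top (ENNReal.mul_ne_top hs2top hVBtop)
    (ENNReal.rpow_ne_top_of_nonneg (by norm_num) (ENNReal.mul_ne_top hcKtop hCftop))
  refine ⟨α + β, ENNReal.add_ne_top.2 ⟨hαtop, hβtop⟩, ?_⟩
  intro ν v₀ v ϖ hv hdss T m hdec hm
  -- the goal with the weaker constants `α`, `β`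
  have hαle : α ≤ α + β := le_self_add
  have hβle : β ≤ α + β := le_add_self
  suffices hmain : ∫⁻ z in Ioo 0 T ×ˢ ball (0 : EuclideanSpace ℝ (Fin 3)) r,
      ‖ϖ z.1 z.2‖ₑ ^ (3 / 2 : ℝ) ≤
      α * (∫⁻ z in Ioo 0 T ×ˢ ball (0 : EuclideanSpace ℝ (Fin 3)) (2 * r),
        ‖v z.1 z.2‖ₑ ^ (3 : ℕ)) + β * ∫⁻ t in Ioo 0 T, m t ^ (3 / 2 : ℝ) by
    exact hmain.trans (add_le_add (mul_le_mul' hαle le_rfl) (mul_le_mul' hβle le_rfl))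
  -- ## names
  set B : Set (EuclideanSpace ℝ (Fin 3)) := ball (0 : EuclideanSpace ℝ (Fin 3)) r with hB
  set N := localPressureNear 0 r v with hN
  set Fa := localPressureFar 0 r v with hFa
  set μt : Measure ℝ := volume.restrict (Ioo 0 T) with hμt
  set μB : Measure (EuclideanSpace ℝ (Fin 3)) := volume.restrict B with hμB
  set G₃ : ℝ≥0∞ := ∫⁻ z in Ioo 0 T ×ˢ ball (0 : EuclideanSpace ℝ (Fin 3)) (2 * r),
    ‖v z.1 z.2‖ₑ ^ (3 : ℕ) with hG₃def
  set g₃ : ℝ → ℝ≥0∞ := fun t => ∫⁻ x in ball (0 : EuclideanSpace ℝ (Fin 3)) (2 * r),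
    ‖v t x‖ₑ ^ (3 : ℕ) with hg₃
  set far : ℝ → ℝ≥0∞ := fun t =>
    ∫⁻ y in (ball (0 : EuclideanSpace ℝ (Fin 3)) (2 * r))ᶜ,
      ‖v t y‖ₑ ^ (2 : ℕ) * RieszKernel.powKer 4 (y - 0) with hfar
  show ∫⁻ z in Ioo 0 T ×ˢ B, ‖ϖ z.1 z.2‖ₑ ^ (3 / 2 : ℝ) ≤
      α * G₃ + β * ∫⁻ t in Ioo 0 T, m t ^ (3 / 2 : ℝ)
  -- ## measurability on the boxes
  have hvm : AEStronglyMeasurable (uncurry v)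
      (volume.restrict (Ioi (0 : ℝ) ×ˢ (univ : Set (EuclideanSpace ℝ (Fin 3))))) :=
    hv.aestronglyMeasurable
  have hbox : ∀ S : Set (EuclideanSpace ℝ (Fin 3)),
      μt.prod (volume.restrict S) = volume.restrict (Ioo 0 T ×ˢ S) := fun S => by
    rw [hμt, Measure.prod_restrict, ← Measure.volume_eq_prod]
  have hsub : ∀ S : Set (EuclideanSpace ℝ (Fin 3)),
      Ioo 0 T ×ˢ S ⊆ Ioi (0 : ℝ) ×ˢ (univ : Set (EuclideanSpace ℝ (Fin 3))) := fun S =>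
    Set.prod_mono Ioo_subset_Ioi_self (subset_univ _)
  have hvmS : ∀ S : Set (EuclideanSpace ℝ (Fin 3)),
      AEStronglyMeasurable (uncurry v) (μt.prod (volume.restrict S)) := fun S => by
    rw [hbox]
    exact hvm.mono_measure (Measure.restrict_mono (hsub S) le_rfl)
  have hF3 : AEMeasurable (fun z : ℝ × EuclideanSpace ℝ (Fin 3) => ‖v z.1 z.2‖ₑ ^ (3 : ℕ))
      (μt.prod (volume.restrict (ball (0 : EuclideanSpace ℝ (Fin 3)) (2 * r)))) :=
    (hvmS _).enorm.pow_const 3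
  have hg₃m : AEMeasurable g₃ μt := hF3.lintegral_prod_right'
  have hT3 : G₃ = ∫⁻ t, g₃ t ∂μt := by
    rw [hG₃def, ← hbox, lintegral_prod _ hF3]
  have hϖm : AEStronglyMeasurable (fun z : ℝ × EuclideanSpace ℝ (Fin 3) => ϖ z.1 z.2)
      (μt.prod μB) := by
    rw [hμB, hbox]
    exact (hv.aestronglyMeasurable_block T B).2
  have hTI : ∫⁻ z in Ioo 0 T ×ˢ B, ‖ϖ z.1 z.2‖ₑ ^ (3 / 2 : ℝ) =
      ∫⁻ t, ∫⁻ x, ‖ϖ t x‖ₑ ^ (3 / 2 : ℝ) ∂μB ∂μt := by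
    rw [← hbox B, ← hμB, lintegral_prod _ (hϖm.enorm.pow_const _)]
  -- ## the case `G₃ = ∞`
  by_cases hG₃ : G₃ = ⊤
  · rw [hG₃, ENNReal.mul_top hα0, top_add]
    exact le_top
  -- ## a.e. in `t`: slice facts
  have hslice_meas := hv.ae_aestronglyMeasurable_slice T
  have hfin : ∀ᵐ t ∂μt, g₃ t < ⊤ := by
    refine ae_lt_top' hg₃m ?_
    rw [← hT3]
    exact hG₃
  have hdec' : ∀ᵐ t ∂μt, ∀ᵐ x ∂μB, ϖ t x = N t x + Fa t x := by
    have h1 : ∀ᵐ z ∂μt.prod μB, ϖ z.1 z.2 = N z.1 z.2 + Fa z.1 z.2 := by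
      rw [hμB, hbox]
      exact hdec
    exact Measure.ae_ae_of_ae_prod h1
  -- ## the slice estimate
  have hinner : ∀ᵐ t ∂μt, ∫⁻ x, ‖ϖ t x‖ₑ ^ (3 / 2 : ℝ) ∂μB ≤
      α * g₃ t + β * m t ^ (3 / 2 : ℝ) := by
    filter_upwards [hslice_meas, hfin, hdec', hm] with t hmt hft hdt hmt'
    -- the far field at time `t`
    have hfar_le : far t ≤ Cf * m t := by
      have h1 := hfarle v hdss t (m t) hmt'
      simp only [hfar, sub_zero]
      exact h1
    have hFaB : ∀ x ∈ B, ‖Fa t x‖ₑ ≤ cK * far t := fun x hx =>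
      enorm_localPressureFar_le hCK0 hCK 0 hr v t hx
    have hM : (cK * far t) ^ (3 / 2 : ℝ) ≤ (cK * Cf) ^ (3 / 2 : ℝ) * m t ^ (3 / 2 : ℝ) := by
      rw [← ENNReal.mul_rpow_of_nonneg _ _ (by norm_num)]
      refine ENNReal.rpow_le_rpow ?_ (by norm_num)
      rw [mul_assoc]
      exact mul_le_mul' le_rfl hfar_le
    -- the near field at time `t`
    have hNt : ∫⁻ x, ‖N t x‖ₑ ^ (3 / 2 : ℝ) ∂μB ≤ Cn * g₃ t :=
      (lintegral_mono' Measure.restrict_le_self le_rfl).trans (hnear 0 r v t hmt hft.ne)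
    -- assemble on the slice
    calc ∫⁻ x, ‖ϖ t x‖ₑ ^ (3 / 2 : ℝ) ∂μB
        = ∫⁻ x, ‖N t x + Fa t x‖ₑ ^ (3 / 2 : ℝ) ∂μB := by
          refine lintegral_congr_ae ?_
          filter_upwards [hdt] with x hx
          rw [hx]
      _ ≤ ∫⁻ x, (‖N t x‖ₑ + cK * far t) ^ (3 / 2 : ℝ) ∂μB := by
          rw [hμB]
          refine setLIntegral_mono' measurableSet_ball fun x hx => ?_
          exact ENNReal.rpow_le_rpow ((enorm_add_le _ _).trans
            (add_le_add le_rfl (hFaB x hx))) (by norm_num)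
      _ ≤ ∫⁻ x, s2 * (‖N t x‖ₑ ^ (3 / 2 : ℝ) + (cK * far t) ^ (3 / 2 : ℝ)) ∂μB :=
          lintegral_mono fun x => add_rpow_threeHalves_le _ _
      _ = s2 * (∫⁻ x, ‖N t x‖ₑ ^ (3 / 2 : ℝ) ∂μB + (cK * far t) ^ (3 / 2 : ℝ) * volume B) := by
          rw [lintegral_const_mul' _ _ hs2top, lintegral_add_right' _ aemeasurable_const,
            lintegral_const, hμB, Measure.restrict_apply_univ]
      _ ≤ s2 * (Cn * g₃ t + (cK * Cf) ^ (3 / 2 : ℝ) * m t ^ (3 / 2 : ℝ) * VB) := by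
          gcongr
      _ = α * g₃ t + β * m t ^ (3 / 2 : ℝ) := by
          rw [hα, hβ]
          ring
  -- ## integrate in time
  calc ∫⁻ z in Ioo 0 T ×ˢ B, ‖ϖ z.1 z.2‖ₑ ^ (3 / 2 : ℝ)
      = ∫⁻ t, ∫⁻ x, ‖ϖ t x‖ₑ ^ (3 / 2 : ℝ) ∂μB ∂μt := hTI
    _ ≤ ∫⁻ t, (α * g₃ t + β * m t ^ (3 / 2 : ℝ)) ∂μt := lintegral_mono_ae hinner
    _ = α * ∫⁻ t, g₃ t ∂μt + β * ∫⁻ t, m t ^ (3 / 2 : ℝ) ∂μt := by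
        rw [lintegral_add_left' (hg₃m.const_mul α), lintegral_const_mul'' _ hg₃m,
          lintegral_const_mul' _ _ hβtop]
    _ = α * G₃ + β * ∫⁻ t in Ioo 0 T, m t ^ (3 / 2 : ℝ) := by rw [hT3]

end BradshawTsai2019

end Literature.Analysis.FluidPDE

end
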